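import Summits.QuantumFields.YangMills.Theorems.LuscherReductionTwistedTraceScalingBOStiffPiTransport
import HarnessLib

/-!
# (B-ST) atom (B3) glue, II: Poincaré transport `ν → π` with a DOMINATED CHANGE OF JUMP KERNEL, and the two-sided transport of jump-form normalisations
# (lane A of S-BASE, crux `TwistedTraceScaling` stmt-QuantumFields-20203, C4-CORE, the (B-ST) pen, hand B; lead g22 INTERFACE FOR hflat, `pub/ym-fleet/INBOX.md` 2026-08-29T22:33:49Z)

The lead's preferred flat form of `hflat` normalises the jump kernel by integrals of the SAME measure: `J₀^ν = cΘ⊗cΘ·cK·(Z_ν/I_ν)` against the flat measure `ν`, `J₀^π = cΘ⊗cΘ·cK·(Z_π/I_π)`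
against `π = orthoTransverse L`, `Z = ∫_S D`, `I = ∫∫ cΘ·cK·cΘ`.  `…BOStiffPiTransport.poincare_transport` moves a Poincaré inequality with door data `(D, J₀)` from `ν` to `π` for a FIXED
kernel; this file adds the two generic bricks that make the lead's `…BOStiffFlatBridge` a short instance (abstract measurable space, `π` finite, any `ν`, two-sided comparison
`ofReal c • ν|_S ≤ π|_S ≤ ofReal C • ν|_S` on the support):
* `jumpForm_ge_of_comparison` — `∫∫ F dπ dπ ≤ C²·∫_S∫_S F dν dν` for `F ≥ 0` bounded jointly measurable vanishing off `S × S` (with ✓`jumpForm_le_of_comparison`: `I_π ∈ [c², C²]·I_ν`;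
  with ✓`setIntegral_le/ge_of_comparison`: `Z_π ∈ [c, C]·Z_ν`); `ratio_le_of_two_sided` — hence `Z_ν/I_ν ≤ (C²/c)·(Z_π/I_π)`;
* `jumpForm_mono_kernel` — the jump form is monotone in the kernel against the non-negative weights `(g x − g y)²`;
* ★★★ `poincare_transport_of_kernel_le` — `hflat(ν; D, J₁, P₀, δ)` and `J₁ ≤ K·J₂` pointwise ⇒ `hflat(π; D, J₂, (C/c²)·K·P₀, (C/c)·δ)`.
So with `K = (Z_ν/I_ν)/(Z_π/I_π) ≤ C²/c`: `P₀ ↦ (C³/c³)·P₀`, `δ ↦ (C/c)·δ`, `β`-free once `c, C` are (✓`orthoTransverse_restrict_cS_sharp`: `c = (1−ε)ρ₀`, `C = (1+ε)ρ₀`).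
HONEST FRAMING: measure bookkeeping for a stub of a child of the CONDITIONAL route R2b1; the flat Poincaré inequality (hand C) and the bridge instance (lead) are NOT in this file; (B-ST) OPEN;
C4-CORE OPEN; not infinite volume, not a gap, not Clay.  No named facts, no `sorry`.
-/

set_option autoImplicit false

noncomputable section

open MeasureTheory Filter Topology Real
open scoped BigOperators ENNReal

namespace Summit.QuantumFields.YangMills.Theorems.FemtoTransferGap.StiffDoor

variable {X : Type*} [MeasurableSpace X] {μ ν : Measure X} [IsFiniteMeasure μ] {S : Set X} {c C : ℝ}

/-- ★ **Jump forms supported in `S × S` transport UPWARD with `C²`**: for `F ≥ 0` bounded jointly measurable with `F x y = 0` unless `x, y ∈ S`,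
`∫∫ F dμ dμ ≤ C²·∫_S ∫_S F dν dν`. [folklore] -/
theorem jumpForm_ge_of_comparison (hc : 0 < c) (hC : 0 ≤ C) (hlo : ENNReal.ofReal c • ν.restrict S ≤ μ.restrict S) (hup : μ.restrict S ≤ ENNReal.ofReal C • ν.restrict S)
    {F : X → X → ℝ} (hF : Measurable (Function.uncurry F)) (hF0 : ∀ x y, 0 ≤ F x y) {CF : ℝ} (hFb : ∀ x y, F x y ≤ CF) (hFS : ∀ x y, F x y ≠ 0 → x ∈ S ∧ y ∈ S) :
    ∫ x, ∫ y, F x y ∂μ ∂μ ≤ C ^ 2 * ∫ x in S, ∫ y in S, F x y ∂ν ∂ν := by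
  haveI := restrict_isFiniteMeasure_of_comparison hc hlo
  have habs : ∀ x y, |F x y| ≤ max CF 0 := fun x y => by rw [abs_of_nonneg (hF0 x y)]; exact (hFb x y).trans (le_max_left _ _)
  -- inner transport, pointwise in `x`
  have hin : ∀ x, ∫ y in S, F x y ∂μ ≤ C * ∫ y in S, F x y ∂ν := fun x => by
    have hmx : Measurable fun y => F x y := hF.comp (measurable_const.prodMk measurable_id)
    exact setIntegral_le_of_comparison (S := S) hc hC hlo hup hmx (hF0 x) (fun y => hFb x y)
  -- the outer integrands are bounded measurable and non-negative
  have hmν : Measurable fun x => ∫ y in S, F x y ∂ν := (hF.stronglyMeasurable.integral_prod_right' (ν := ν.restrict S)).measurable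
  have hbν : ∀ x, |∫ y in S, F x y ∂ν| ≤ max CF 0 * (ν.restrict S).real Set.univ := fun x => by
    have h := norm_integral_le_of_norm_le_const (μ := ν.restrict S) (f := fun y => F x y) (C := max CF 0) (Filter.Eventually.of_forall fun y => by
      rw [Real.norm_eq_abs]; exact habs x y)
    rw [Real.norm_eq_abs] at h
    linarith [mul_comm (max CF 0) ((ν.restrict S).real Set.univ)]
  have h0ν : ∀ x, 0 ≤ ∫ y in S, F x y ∂ν := fun x => integral_nonneg fun y => hF0 x y
  -- restrict the `μ`-form to `S × S`
  rw [← jumpForm_restrict_eq (μ := μ) hFS]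
  have hstep1 : ∫ x in S, ∫ y in S, F x y ∂μ ∂μ ≤ ∫ x in S, C * ∫ y in S, F x y ∂ν ∂μ := by
    refine integral_mono_of_nonneg (ae_of_all _ fun x => integral_nonneg fun y => hF0 x y) ?_ (ae_of_all _ hin)
    exact (Integrable.of_bound hmν.aestronglyMeasurable (max CF 0 * (ν.restrict S).real Set.univ) (ae_of_all _ fun x => by
      rw [Real.norm_eq_abs]; exact hbν x)).const_mul _
  have hstep2 : ∫ x in S, C * ∫ y in S, F x y ∂ν ∂μ = C * ∫ x in S, ∫ y in S, F x y ∂ν ∂μ := integral_const_mul _ _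
  have hstep3 : ∫ x in S, ∫ y in S, F x y ∂ν ∂μ ≤ C * ∫ x in S, ∫ y in S, F x y ∂ν ∂ν :=
    setIntegral_le_of_comparison (S := S) hc hC hlo hup hmν h0ν (Cf := max CF 0 * (ν.restrict S).real Set.univ) fun x => (le_abs_self _).trans (hbν x)
  calc ∫ x in S, ∫ y in S, F x y ∂μ ∂μ ≤ C * ∫ x in S, ∫ y in S, F x y ∂ν ∂μ := hstep1.trans_eq hstep2
    _ ≤ C * (C * ∫ x in S, ∫ y in S, F x y ∂ν ∂ν) := mul_le_mul_of_nonneg_left hstep3 hC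
    _ = C ^ 2 * ∫ x in S, ∫ y in S, F x y ∂ν ∂ν := by rw [← mul_assoc, sq]

omit [MeasurableSpace X] [IsFiniteMeasure μ] in
/-- Normalisation ratios under two-sided comparison: `c·Z_ν ≤ Z_π`, `I_π ≤ C²·I_ν`, `I_ν, I_π > 0`, `Z_π ≥ 0` ⇒ `Z_ν/I_ν ≤ (C²/c)·(Z_π/I_π)`. [folklore] -/
theorem ratio_le_of_two_sided {Zν Zπ Iν Iπ : ℝ} (hc : 0 < c) (hZ : c * Zν ≤ Zπ) (hI : Iπ ≤ C ^ 2 * Iν) (hIν : 0 < Iν) (hIπ : 0 < Iπ) (hZπ : 0 ≤ Zπ) :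
    Zν / Iν ≤ C ^ 2 / c * (Zπ / Iπ) := by
  rw [div_le_iff₀ hIν]
  have h1 : Zν ≤ Zπ / c := by rw [le_div_iff₀ hc]; linarith [mul_comm c Zν]
  have h2 : Zπ / c ≤ C ^ 2 / c * (Zπ / Iπ) * Iν := by
    have : C ^ 2 / c * (Zπ / Iπ) * Iν = (Zπ / c) * (C ^ 2 * Iν / Iπ) := by field_simp
    rw [this]
    exact le_mul_of_one_le_right (div_nonneg hZπ hc.le) (by rw [le_div_iff₀ hIπ, one_mul]; exact hI)
  exact h1.trans h2

/-- ★ **The jump form is monotone in the kernel**: `J₁ ≤ K·J₂` pointwise ⇒ `∫∫ (g x − g y)²J₁ dμ dμ ≤ K·∫∫ (g x − g y)²J₂ dμ dμ` (bounded measurable data, `μ` finite). [folklore] -/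
theorem jumpForm_mono_kernel {g : X → ℝ} {J₁ J₂ : X → X → ℝ} {Cg CJ₁ CJ₂ K : ℝ} (hg : Measurable g) (hgb : ∀ x, |g x| ≤ Cg)
    (hJ₁ : Measurable (Function.uncurry J₁)) (hJ₁b : ∀ x y, |J₁ x y| ≤ CJ₁) (hJ₂ : Measurable (Function.uncurry J₂)) (hJ₂b : ∀ x y, |J₂ x y| ≤ CJ₂)
    (hJK : ∀ x y, J₁ x y ≤ K * J₂ x y) :
    ∫ x, ∫ y, (g x - g y) ^ 2 * J₁ x y ∂μ ∂μ ≤ K * ∫ x, ∫ y, (g x - g y) ^ 2 * J₂ x y ∂μ ∂μ := by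
  have hd : Measurable (Function.uncurry fun x y => (g x - g y) ^ 2) := ((hg.comp measurable_fst).sub (hg.comp measurable_snd)).pow_const 2
  have hdb : ∀ x y, |(g x - g y) ^ 2| ≤ (2 * Cg) ^ 2 := fun x y => by
    rw [abs_pow]; exact pow_le_pow_left₀ (abs_nonneg _) ((abs_sub _ _).trans (by linarith [hgb x, hgb y])) 2
  have hF1 : Measurable (Function.uncurry fun x y => (g x - g y) ^ 2 * J₁ x y) := hd.mul hJ₁
  have hF2 : Measurable (Function.uncurry fun x y => K * ((g x - g y) ^ 2 * J₂ x y)) := measurable_const.mul (hd.mul hJ₂)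
  have hF1b : ∀ x y, |(g x - g y) ^ 2 * J₁ x y| ≤ (2 * Cg) ^ 2 * CJ₁ := fun x y => by
    rw [abs_mul]; exact mul_le_mul (hdb x y) (hJ₁b x y) (abs_nonneg _) (sq_nonneg _)
  have hF2b : ∀ x y, |K * ((g x - g y) ^ 2 * J₂ x y)| ≤ |K| * ((2 * Cg) ^ 2 * CJ₂) := fun x y => by
    rw [abs_mul, abs_mul]; exact mul_le_mul_of_nonneg_left (mul_le_mul (hdb x y) (hJ₂b x y) (abs_nonneg _) (sq_nonneg _)) (abs_nonneg _)
  have e2 : K * ∫ x, ∫ y, (g x - g y) ^ 2 * J₂ x y ∂μ ∂μ = ∫ x, ∫ y, K * ((g x - g y) ^ 2 * J₂ x y) ∂μ ∂μ := by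
    rw [← integral_const_mul]
    exact integral_congr_ae (ae_of_all _ fun x => (integral_const_mul _ _).symm)
  rw [e2, integral_integral_eq_prod (μ := μ) hF1 hF1b, integral_integral_eq_prod (μ := μ) hF2 hF2b]
  refine integral_mono (integrable_prod_of_bdd (μ := μ) hF1 hF1b) (integrable_prod_of_bdd (μ := μ) hF2 hF2b) fun p => ?_
  dsimp only [Function.uncurry]
  have := hJK p.1 p.2
  nlinarith [sq_nonneg (g p.1 - g p.2)]

/-- ★★★ **POINCARÉ TRANSPORT `ν → π` WITH A DOMINATED CHANGE OF KERNEL.**  As `poincare_transport`, with the flat inequality stated for a kernel `J₁ ≥ 0` (bounded jointly measurable,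
vanishing off `S × S`) and the conclusion for any bounded jointly measurable kernel `J₂` with `J₁ ≤ K·J₂` pointwise (any real `K`):
`hflat(ν; D, J₁, P₀, δ) ⇒ hflat(π; D, J₂, (C/c²)·K·P₀, (C/c)·δ)`. [cite: Helffer2013, §7] -/
theorem poincare_transport_of_kernel_le (hc : 0 < c) (hC : 0 ≤ C) (hlo : ENNReal.ofReal c • ν.restrict S ≤ μ.restrict S) (hup : μ.restrict S ≤ ENNReal.ofReal C • ν.restrict S)
    {g D : X → ℝ} {J₁ J₂ : X → X → ℝ} {Cg CD CJ₁ CJ₂ K P₀ δ : ℝ}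
    (hg : Measurable g) (hgb : ∀ x, |g x| ≤ Cg) (hD : Measurable D) (hDb : ∀ x, |D x| ≤ CD) (hD0 : ∀ x, 0 ≤ D x)
    (hJ₁ : Measurable (Function.uncurry J₁)) (hJ₁b : ∀ x y, |J₁ x y| ≤ CJ₁) (hJ₁0 : ∀ x y, 0 ≤ J₁ x y) (hJ₁S : ∀ x y, J₁ x y ≠ 0 → x ∈ S ∧ y ∈ S)
    (hJ₂ : Measurable (Function.uncurry J₂)) (hJ₂b : ∀ x y, |J₂ x y| ≤ CJ₂) (hJK : ∀ x y, J₁ x y ≤ K * J₂ x y) (hP₀ : 0 ≤ P₀) (hδ : 0 ≤ δ)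
    (hflat : (∫ x in S, g x ^ 2 * D x ∂ν) - (∫ x in S, g x * D x ∂ν) ^ 2 / (∫ x in S, D x ∂ν) ≤
      P₀ * ((1 / 2) * ∫ x in S, ∫ y in S, (g x - g y) ^ 2 * J₁ x y ∂ν ∂ν) + δ * ∫ x in S, g x ^ 2 * D x ∂ν) :
    (∫ x in S, g x ^ 2 * D x ∂μ) - (∫ x in S, g x * D x ∂μ) ^ 2 / (∫ x in S, D x ∂μ) ≤
      (C / c ^ 2 * K * P₀) * ((1 / 2) * ∫ x, ∫ y, (g x - g y) ^ 2 * J₂ x y ∂μ ∂μ) + (C / c * δ) * ∫ x in S, g x ^ 2 * D x ∂μ := by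
  have h1 := poincare_transport (μ := μ) (ν := ν) hc hC hlo hup hg hgb hD hDb hD0 hJ₁ hJ₁b hJ₁0 hJ₁S hP₀ hδ hflat
  have h2 := jumpForm_mono_kernel (μ := μ) hg hgb hJ₁ hJ₁b hJ₂ hJ₂b hJK
  have hcoef : 0 ≤ C / c ^ 2 * P₀ := by positivity
  calc (∫ x in S, g x ^ 2 * D x ∂μ) - (∫ x in S, g x * D x ∂μ) ^ 2 / (∫ x in S, D x ∂μ)
      ≤ (C / c ^ 2 * P₀) * ((1 / 2) * ∫ x, ∫ y, (g x - g y) ^ 2 * J₁ x y ∂μ ∂μ) + (C / c * δ) * ∫ x in S, g x ^ 2 * D x ∂μ := h1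
    _ ≤ (C / c ^ 2 * P₀) * ((1 / 2) * (K * ∫ x, ∫ y, (g x - g y) ^ 2 * J₂ x y ∂μ ∂μ)) + (C / c * δ) * ∫ x in S, g x ^ 2 * D x ∂μ := by
        gcongr
    _ = (C / c ^ 2 * K * P₀) * ((1 / 2) * ∫ x, ∫ y, (g x - g y) ^ 2 * J₂ x y ∂μ ∂μ) + (C / c * δ) * ∫ x in S, g x ^ 2 * D x ∂μ := by ring

end Summit.QuantumFields.YangMills.Theorems.FemtoTransferGap.StiffDoor

end
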